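import Mathlib.Analysis.SpecialFunctions.Log.Basic
import Mathlib.Analysis.SpecialFunctions.Sqrt
import Mathlib.Algebra.BigOperators.Ring.Finset
import Mathlib.Algebra.Order.BigOperators.Ring.Finset
import Literature.ComputerArithmetic.ConnollyHighamMary2021.ProbabilisticBounds
import HarnessLib

/-!
# El Arar–Fasi–Filip–Mikaitis 2026: limited-precision SR — Horner's algorithm and pairwise summation

HONEST FRAMING: certified error envelopes and provably optimal rounding/accumulation schemes for
low-precision formats under stated cost models; every table by two implementations; no hardware
or vendor claims.

Source. E.-M. El Arar, M. Fasi, S.-I. Filip, M. Mikaitis, *Probabilistic error analysis of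
limited-precision stochastic rounding: Horner's algorithm and pairwise summation*, arXiv:2603.24161
(March 2026) [cite: ArarEtAl2026]; its Lemma 1 is Lemma 3.10 of the same authors' SIAM J. Sci.
Comput. 47(5) (2025) paper [cite: ElararEtAl2025] (= arXiv:2408.03069, there Lemma 5), whose proof
("because |α_k| ≤ u_p and |β_k| ≤ u_{p+r}") fixes the bounds used below. Page pointers are to the
arXiv text of 2603.24161 (pp. 3–9).

The setting (§2 of the source, typed in `Literature.ComputerArithmetic.ElararEtAl2025`): `SR_{p,r}`
rounds `x` up with probability `q_r(x) = (fl_{p+r}(x) − ⌊x⌋_p)/(⌈x⌉_p − ⌊x⌋_p)`; its relative error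
`δ` (`SR_{p,r}(x) = x(1+δ)`, `|δ| ≤ u_p = 2^{1−p}`) has mean `E δ = β`, the relative error of the
truncation `fl_{p+r}(x) = x(1+β)`, `|β| ≤ u_{p+r}` (eqs. (3)–(4)).

What is typed here.
* (7): `γ_m(u) = (1+u)^m − 1` (`gammaFn`).
* **Lemma 1** (= [ElararEtAl2025, Lem. 3.10]), DETERMINISTIC PART — PROVED over any linearly ordered
  field: writing `δ_k = α_k + β_k`, `∏_{k∈I}(1+δ_k) = ∏_{k∈I}(1+α_k) + B_I` with
  `B_I = Σ_{K ⊊ I} (∏_{i∈K}(1+α_i)) ∏_{j∈I∖K} β_j` (`biasTerm`, `prod_one_add_add_eq`), and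
  `|B_I| ≤ γ_{|I|}(u_p + u_{p+r}) − γ_{|I|}(u_p)` whenever `|α_k| ≤ u_p`, `|β_k| ≤ u_{p+r}`
  (`abs_biasTerm_le`).
* **Lemma 1**, PROBABILISTIC PART, as the LIMITED-PRECISION SR ERROR MODEL (a structure of
  hypotheses, exactly as `ConnollyHighamMary2021.SRErrorModel` types CHM21 Lemma 4.5): the
  `α_k = δ_k − β_k` are measurable, bounded by `u_p`, and MEAN INDEPENDENT WITH MEAN ZERO
  (`E(α_k | α_1,…,α_{k−1}) = E(α_k) = 0`, test-function form); the `β_k` are measurable and bounded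
  by `u_{p+r}` (`LimitedSRErrorModel`). The paper derives these properties from the definition of
  `SR_{p,r}` acting on the computed intermediate quantities; here they are the hypotheses under
  which Theorems 1–2 are stated, so the two named facts below assert exactly what the paper's proofs
  establish from Lemma 1 on.
* **Theorem 1** (Horner's rule `P(x) = Σ_{i=0}^{n} a_i x^i` under `SR_{p,r}`, eq. (8):
  `P̂(x) = Σ_{i=0}^{n} a_i x^i ∏_{k=2(n−i)}^{2n} (1+δ_k)` with `δ_0 = 0`; eq. (9)): for `0 < λ < 1`,
  `|P̂(x) − P(x)| ≤ (Σ_i |a_i x^i|)·(√(u_p γ_{4n}(u_p)) √(ln(2/λ)) + γ_{2n}(u_p+u_{p+r}) − γ_{2n}(u_p))`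
  with probability at least `1 − λ` — NAMED FACT `hornerBoundSRpr` (the paper divides by `|P(x)|`
  and writes the factor as the condition number `κ(P) = Σ|a_i||x|^i/|P(x)|`, eq. (6); we state the
  multiplied-out form, which is the same inequality and needs no `P(x) ≠ 0`).
* **Theorem 2** (pairwise summation of `n = 2^h` summands, §4: `ŝ = Σ_{i=1}^{2^h} a_i ∏_{j=1}^{h}
  (1 + δ_{j,⌈i/2^j⌉})`; eq. (13) with `⌈log₂ n⌉ = h`): for `0 < λ < 1`,
  `|ŝ − s| ≤ (Σ_i |a_i|)·(√(u_p γ_{2h}(u_p)) √(ln(2/λ)) + γ_h(u_p+u_{p+r}) − γ_h(u_p))` with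
  probability at least `1 − λ` — NAMED FACT `pairwiseBoundSRpr` (again the multiplied-out form of
  the paper's `κ(a) = Σ|a_i|/|s|`). The tree's rounding errors `δ_{j,m}` (level `j`, node `m`) are
  read from ONE error sequence through an injective numbering `ι j m` that is increasing along every
  root path (children are rounded before parents — every execution order of the algorithm is such a
  numbering), and mean independence is in that order, as in the source ("using the same notation as
  [9]" = El Arar–Sohier–de Oliveira Castro–Petit, SIAM J. Sci. Comput. 46(5) (2024), Thm. 3.5).

Probabilities are typed as in `ConnollyHighamMary2021.productBoundCHM`: "`E` holds with probability
at least `1 − λ`" is `μ {ω | ¬E ω} ≤ λ` on a probability space (no measurability side condition is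
needed for an upper bound on an outer measure). The hypotheses `0 < u_{p+r} ≤ u_p < 1` record
`u_p = 2^{1−p}`, `u_{p+r} = 2^{1−p−r}`, `p ≥ 2`, `r ≥ 1` of the source (they only weaken the facts).

NOT typed here: Remarks 2 and 4 (the rules of thumb `r ≈ ⌈log₂(n)/2⌉`, `r ≈ ⌈log₂(log₂ n)/2⌉`,
`r ≈ ⌈log₂(k)/2⌉` — heuristics, not theorems), Remark 3 (FMA, left open by the authors), §5
(experiments). The exact finite-format counterparts for the IEEE P3109 rules `StochasticA/B/C`
(per-step and `n`-step bias, mean square error, any summation tree) are the venture files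
`Summits/Ventures/CertifiedArithmetic/LowPrec/SRLimitedBits*.lean`, `SRTreeLimitedBits*.lean`.

Transcription note (for the reviewer): the displays (9) and (13) are transcribed from the arXiv
text, pp. 5–8 (`√(u_p γ_{4n}(u_p)) √(ln(2/λ)) + γ_{2n}(u_p+u_{p+r}) − γ_{2n}(u_p)` for Horner,
`√(u_p γ_{2⌈log₂ n⌉}(u_p)) √(ln(2/λ)) + γ_{⌈log₂ n⌉}(u_p+u_{p+r}) − γ_{⌈log₂ n⌉}(u_p)` for pairwise
summation, the latter confirmed by the last display of the proof, `U_n`, p. 8).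
-/

namespace Literature.ComputerArithmetic.ElararEtAl2026

open _root_.MeasureTheory
open Finset
open Literature.ComputerArithmetic.ConnollyHighamMary2021 (SRErrorModel)

section Deterministic

variable {K : Type*} [Field K] [LinearOrder K] [IsStrictOrderedRing K]

/-- The error function `γ_m(u) = (1+u)^m − 1` (`= mu + O(u²)` for `mu ≪ 1`).
[cite: ArarEtAl2026, §3 eq. (7)] -/
def gammaFn (m : ℕ) (u : K) : K := (1 + u) ^ m - 1

/-- The bias term of Lemma 1: `B_I = Σ_{K ⊊ I} (∏_{i∈K}(1+α_i)) · ∏_{j∈I∖K} β_j` (sum over the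
proper subsets `K` of the index set `I`). [cite: ArarEtAl2026, Lemma 1] -/
def biasTerm {ι : Type*} [DecidableEq ι] (I : Finset ι) (α β : ι → K) : K :=
  ∑ T ∈ I.ssubsets, (∏ k ∈ T, (1 + α k)) * ∏ j ∈ I \ T, β j

omit [LinearOrder K] [IsStrictOrderedRing K] in
/-- **Lemma 1, the decomposition** `∏_{k∈I}(1+δ_k) = ∏_{k∈I}(1+α_k) + B_I` for `δ_k = α_k + β_k`
(expand `∏((1+α_k) + β_k)` over subsets and split off `K = I`). PROVED.
[cite: ArarEtAl2026, Lemma 1] -/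
theorem prod_one_add_add_eq {ι : Type*} [DecidableEq ι] (I : Finset ι) (α β : ι → K) :
    ∏ k ∈ I, (1 + (α k + β k)) = (∏ k ∈ I, (1 + α k)) + biasTerm I α β := by
  have h := Finset.prod_add (fun k => 1 + α k) (fun k => β k) I
  simp only [← add_assoc] at h ⊢
  rw [h, biasTerm, Finset.ssubsets, Finset.sum_erase_eq_sub (Finset.mem_powerset_self I),
    Finset.sdiff_self, Finset.prod_empty, mul_one]
  ring

omit [LinearOrder K] [IsStrictOrderedRing K] in
/-- `γ_m(a+b) − γ_m(a) = (1+a+b)^m − (1+a)^m`. [cite: ArarEtAl2026, §3 eq. (7)] -/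
theorem gammaFn_sub_gammaFn (m : ℕ) (a b : K) :
    gammaFn m (a + b) - gammaFn m a = (1 + a + b) ^ m - (1 + a) ^ m := by
  unfold gammaFn; ring

/-- **Lemma 1, the bound** `|B_I| ≤ γ_{|I|}(u_p + u_{p+r}) − γ_{|I|}(u_p)` when `|α_k| ≤ u_p` and
`|β_k| ≤ u_{p+r}` on `I` ("because `|α_k| ≤ u_p` and `|β_k| ≤ u_{p+r}`": bound each subset term by
`(1+u_p)^{|K|} u_{p+r}^{|I∖K|}` and resum with the binomial theorem). PROVED.
[cite: ArarEtAl2026, Lemma 1] -/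
theorem abs_biasTerm_le {ι : Type*} [DecidableEq ι] (I : Finset ι) (α β : ι → K) {a b : K}
    (ha : 0 ≤ a) (hα : ∀ k ∈ I, |α k| ≤ a) (hβ : ∀ k ∈ I, |β k| ≤ b) :
    |biasTerm I α β| ≤ gammaFn I.card (a + b) - gammaFn I.card a := by
  -- termwise bound over every subset `T ⊆ I`
  have hterm : ∀ T ∈ I.powerset,
      |(∏ k ∈ T, (1 + α k)) * ∏ j ∈ I \ T, β j| ≤ (∏ _k ∈ T, (1 + a)) * ∏ _j ∈ I \ T, b := by
    intro T hT
    have hTI : T ⊆ I := Finset.mem_powerset.mp hT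
    rw [abs_mul, Finset.abs_prod, Finset.abs_prod]
    refine mul_le_mul ?_ ?_ (Finset.prod_nonneg fun j _ => abs_nonneg _)
      (Finset.prod_nonneg fun k _ => by linarith)
    · refine Finset.prod_le_prod (fun k _ => abs_nonneg _) fun k hk => ?_
      calc |1 + α k| ≤ |(1 : K)| + |α k| := abs_add_le 1 (α k)
        _ ≤ 1 + a := by rw [abs_one]; linarith [hα k (hTI hk)]
    · exact Finset.prod_le_prod (fun j _ => abs_nonneg _)
        fun j hj => hβ j (Finset.sdiff_subset hj)
  -- the binomial resummation `Σ_{T ⊆ I} (1+a)^{|T|} b^{|I∖T|} = (1+a+b)^{|I|}`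
  have hsum : ∑ T ∈ I.powerset, (∏ _k ∈ T, (1 + a)) * ∏ _j ∈ I \ T, b = (1 + a + b) ^ I.card := by
    rw [← Finset.prod_add, Finset.prod_const]
  have hfull : (∏ _k ∈ I, (1 + a)) * ∏ _j ∈ I \ I, b = (1 + a) ^ I.card := by
    rw [Finset.sdiff_self, Finset.prod_empty, mul_one, Finset.prod_const]
  calc |biasTerm I α β|
      ≤ ∑ T ∈ I.ssubsets, |(∏ k ∈ T, (1 + α k)) * ∏ j ∈ I \ T, β j| :=
        Finset.abs_sum_le_sum_abs _ _
    _ ≤ ∑ T ∈ I.ssubsets, (∏ _k ∈ T, (1 + a)) * ∏ _j ∈ I \ T, b :=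
        Finset.sum_le_sum fun T hT => hterm T (Finset.mem_of_mem_erase hT)
    _ = (1 + a + b) ^ I.card - (1 + a) ^ I.card := by
        rw [Finset.ssubsets, Finset.sum_erase_eq_sub (Finset.mem_powerset_self I), hsum, hfull]
    _ = gammaFn I.card (a + b) - gammaFn I.card a := (gammaFn_sub_gammaFn _ _ _).symm

/-- Consequently `|∏_{k∈I}(1+α_k+β_k) − ∏_{k∈I}(1+α_k)| ≤ γ_{|I|}(u_p+u_{p+r}) − γ_{|I|}(u_p)`.
PROVED. [cite: ArarEtAl2026, Lemma 1] -/
theorem abs_prod_sub_prod_le {ι : Type*} [DecidableEq ι] (I : Finset ι) (α β : ι → K) {a b : K}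
    (ha : 0 ≤ a) (hα : ∀ k ∈ I, |α k| ≤ a) (hβ : ∀ k ∈ I, |β k| ≤ b) :
    |(∏ k ∈ I, (1 + (α k + β k))) - ∏ k ∈ I, (1 + α k)|
      ≤ gammaFn I.card (a + b) - gammaFn I.card a := by
  rw [prod_one_add_add_eq, add_sub_cancel_left]
  exact abs_biasTerm_le I α β ha hα hβ

end Deterministic

/-! ### The limited-precision SR error model and the two probabilistic bounds (named facts) -/

/-- **Lemma 1, probabilistic part: the limited-precision SR error model.** The rounding errors of a
sequence of elementary operations under `SR_{p,r}` are `δ_k = α_k + β_k` where the `α_k` are real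
random variables on a probability space, measurable, bounded by `u_p` and MEAN INDEPENDENT WITH
MEAN ZERO — `E(α_k | α_1,…,α_{k−1}) = E(α_k) = 0`, typed in the test-function form of
`ConnollyHighamMary2021.SRErrorModel` — and the truncation errors `β_k` are measurable and bounded
by `u_{p+r}`. (In the source these properties are DERIVED from the definition of `SR_{p,r}`; here
they are the standing hypotheses of Theorems 1–2, cf. the module docstring.)
[cite: ArarEtAl2026, Lemma 1] -/
structure LimitedSRErrorModel {Ω : Type*} [MeasurableSpace Ω] (μ : Measure Ω) (up upr : ℝ)
    (α β : ℕ → Ω → ℝ) : Prop where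
  meanIndep : SRErrorModel μ up α
  biasMeasurable : ∀ k, Measurable (β k)
  biasBounded : ∀ k ω, |β k ω| ≤ upr

/-- Pathwise form of Lemma 1 in the model: for every finite set `I` of error indices and every
outcome `ω`, `|∏_{k∈I}(1+δ_k) − ∏_{k∈I}(1+α_k)| ≤ γ_{|I|}(u_p+u_{p+r}) − γ_{|I|}(u_p)`. PROVED
(from `abs_prod_sub_prod_le`). [cite: ArarEtAl2026, Lemma 1] -/
theorem LimitedSRErrorModel.abs_prod_sub_prod_le {Ω : Type*} [MeasurableSpace Ω] {μ : Measure Ω}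
    {up upr : ℝ} {α β : ℕ → Ω → ℝ} (h : LimitedSRErrorModel μ up upr α β) (hup : 0 ≤ up)
    (I : Finset ℕ) (ω : Ω) :
    |(∏ k ∈ I, (1 + (α k ω + β k ω))) - ∏ k ∈ I, (1 + α k ω)|
      ≤ gammaFn I.card (up + upr) - gammaFn I.card up :=
  ElararEtAl2026.abs_prod_sub_prod_le I (fun k => α k ω) (fun k => β k ω) hup
    (fun k _ => h.meanIndep.bounded k ω) (fun k _ => h.biasBounded k ω)

/-- Horner's rule in the standard model, eq. (8): with the `2n` rounding errors `δ_1,…,δ_{2n}` of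
`r̂_{2k−1} = fl(r̂_{2k−2}x)`, `r̂_{2k} = fl(r̂_{2k−1} + a_{n−k})` in time order,
`P̂(x) = Σ_{i=0}^{n} a_i x^i ∏_{k=2(n−i)}^{2n} (1+δ_k)` with the convention `δ_0 = 0` (so the
`i = n` term carries `δ_1,…,δ_{2n}`): here the product runs over `max(1, 2(n−i)) ≤ k ≤ 2n`.
[cite: ArarEtAl2026, §3 eq. (8)] -/
def hornerComputed (n : ℕ) (a : ℕ → ℝ) (x : ℝ) (δ : ℕ → ℝ) : ℝ :=
  ∑ i ∈ range (n + 1), a i * x ^ i * ∏ k ∈ Icc (max 1 (2 * (n - i))) (2 * n), (1 + δ k)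

/-- The error envelope of Theorem 1, eq. (9), multiplied by `|P(x)|`:
`√(u_p γ_{4n}(u_p)) √(ln(2/λ)) + γ_{2n}(u_p+u_{p+r}) − γ_{2n}(u_p)` (times `Σ|a_i x^i|` below).
[cite: ArarEtAl2026, Thm. 1 eq. (9)] -/
noncomputable def hornerEnvelope (n : ℕ) (up upr lam : ℝ) : ℝ :=
  Real.sqrt (up * gammaFn (4 * n) up) * Real.sqrt (Real.log (2 / lam))
    + (gammaFn (2 * n) (up + upr) - gammaFn (2 * n) up)

/-- **Theorem 1 (Horner's algorithm under `SR_{p,r}`).** For every `0 < λ < 1`, the computed value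
(8) satisfies `|P̂(x) − P(x)| ≤ (Σ_{i=0}^{n} |a_i x^i|)·(√(u_p γ_{4n}(u_p)) √(ln(2/λ)) +
γ_{2n}(u_p+u_{p+r}) − γ_{2n}(u_p))` with probability at least `1 − λ` (the source states the
relative form with `κ(P) = Σ|a_i||x|^i/|P(x)|`, eq. (6)). Named fact, stated over the
limited-precision SR error model. [cite: ArarEtAl2026, Thm. 1] -/
def hornerBoundSRpr : Prop :=
  ∀ (Ω : Type) [MeasurableSpace Ω] (μ : Measure Ω) [IsProbabilityMeasure μ] (up upr : ℝ)
    (α β : ℕ → Ω → ℝ), 0 < upr → upr ≤ up → up < 1 → LimitedSRErrorModel μ up upr α β →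
    ∀ (n : ℕ) (a : ℕ → ℝ) (x lam : ℝ), 0 < lam → lam < 1 →
      μ {ω | (∑ i ∈ range (n + 1), |a i * x ^ i|) * hornerEnvelope n up upr lam
              < |hornerComputed n a x (fun k => α k ω + β k ω) - ∑ i ∈ range (n + 1), a i * x ^ i|}
        ≤ ENNReal.ofReal lam

/-- Pairwise summation of `n = 2^h` summands in the standard model, §4: leaf `i` (here `0 ≤ i < 2^h`;
the source counts from `1`) passes through the nodes `m = ⌊i/2^j⌋` of levels `j = 1,…,h`, and
`ŝ = Σ_i a_i ∏_{j=1}^{h} (1 + δ_{j,⌊i/2^j⌋})`; the doubly indexed errors are read from one error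
sequence through the numbering `ι j m`. [cite: ArarEtAl2026, §4 (display before Thm. 2)] -/
def pairwiseComputed (h : ℕ) (a : ℕ → ℝ) (ι : ℕ → ℕ → ℕ) (δ : ℕ → ℝ) : ℝ :=
  ∑ i ∈ range (2 ^ h), a i * ∏ j ∈ Icc 1 h, (1 + δ (ι j (i / 2 ^ j)))

/-- An admissible numbering of the internal nodes `(j, m)`, `1 ≤ j ≤ h`, `m < 2^{h−j}`, of the
summation tree by positions of ONE error sequence: injective, and increasing from children to parent
along every root path (every execution order of pairwise summation is one).
[cite: ArarEtAl2026, §4] -/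
structure TreeNumbering (h : ℕ) (ι : ℕ → ℕ → ℕ) : Prop where
  inj : ∀ j m j' m', 1 ≤ j → j ≤ h → m < 2 ^ (h - j) → 1 ≤ j' → j' ≤ h → m' < 2 ^ (h - j') →
    ι j m = ι j' m' → j = j' ∧ m = m'
  mono : ∀ j m, 1 ≤ j → j < h → m < 2 ^ (h - j) → ι j m < ι (j + 1) (m / 2)

/-- The error envelope of Theorem 2, eq. (13) with `⌈log₂ n⌉ = h`, multiplied by `|s|`:
`√(u_p γ_{2h}(u_p)) √(ln(2/λ)) + γ_h(u_p+u_{p+r}) − γ_h(u_p)` (times `Σ|a_i|` below).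
[cite: ArarEtAl2026, Thm. 2 eq. (13)] -/
noncomputable def pairwiseEnvelope (h : ℕ) (up upr lam : ℝ) : ℝ :=
  Real.sqrt (up * gammaFn (2 * h) up) * Real.sqrt (Real.log (2 / lam))
    + (gammaFn h (up + upr) - gammaFn h up)

/-- **Theorem 2 (pairwise summation under `SR_{p,r}`).** For every `0 < λ < 1`, the computed sum of
`n = 2^h` summands satisfies `|ŝ − s| ≤ (Σ_i |a_i|)·(√(u_p γ_{2h}(u_p)) √(ln(2/λ)) + γ_h(u_p+u_{p+r})
− γ_h(u_p))` with probability at least `1 − λ` (the source states the relative form with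
`κ(a) = Σ|a_i|/|s|` and `⌈log₂ n⌉` for `h`; `2^{h−1} < n < 2^h` is reduced to `n = 2^h` by zero
padding). Named fact, stated over the limited-precision SR error model read through an admissible
tree numbering. [cite: ArarEtAl2026, Thm. 2] -/
def pairwiseBoundSRpr : Prop :=
  ∀ (Ω : Type) [MeasurableSpace Ω] (μ : Measure Ω) [IsProbabilityMeasure μ] (up upr : ℝ)
    (α β : ℕ → Ω → ℝ), 0 < upr → upr ≤ up → up < 1 → LimitedSRErrorModel μ up upr α β →
    ∀ (h : ℕ) (ι : ℕ → ℕ → ℕ), TreeNumbering h ι → ∀ (a : ℕ → ℝ) (lam : ℝ), 0 < lam → lam < 1 →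
      μ {ω | (∑ i ∈ range (2 ^ h), |a i|) * pairwiseEnvelope h up upr lam
              < |pairwiseComputed h a ι (fun k => α k ω + β k ω) - ∑ i ∈ range (2 ^ h), a i|}
        ≤ ENNReal.ofReal lam

/-! ### Sanity links (proved) -/

/-- With no rounding errors the model value (8) is `P(x)` itself (sanity link for the transcription
of (8)). [cite: ArarEtAl2026, §3 eq. (8)] -/
theorem hornerComputed_zero (n : ℕ) (a : ℕ → ℝ) (x : ℝ) :
    hornerComputed n a x (fun _ => 0) = ∑ i ∈ range (n + 1), a i * x ^ i := by
  simp [hornerComputed]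

/-- With no rounding errors the model value of §4 is `s` itself (sanity link for the transcription
of the display before Theorem 2). [cite: ArarEtAl2026, §4 (display before Thm. 2)] -/
theorem pairwiseComputed_zero (h : ℕ) (a : ℕ → ℝ) (ι : ℕ → ℕ → ℕ) :
    pairwiseComputed h a ι (fun _ => 0) = ∑ i ∈ range (2 ^ h), a i := by
  simp [pairwiseComputed]

/-- The `i = n` term of (8) carries all `2n` errors and the `i = 0` term only the last one:
a check of the index bookkeeping `max(1, 2(n−i)) … 2n` for `n = 1`,
`P̂ = a_1 x (1+δ_1)(1+δ_2) + a_0 (1+δ_2)` — the recursion displayed before (8) for one Horner step.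
[cite: ArarEtAl2026, §3 eq. (8)] -/
theorem hornerComputed_one (a : ℕ → ℝ) (x : ℝ) (δ : ℕ → ℝ) :
    hornerComputed 1 a x δ = a 0 * (1 + δ 2) + a 1 * x * ((1 + δ 1) * (1 + δ 2)) := by
  simp [hornerComputed, Finset.sum_range_succ, show Icc 1 2 = {1, 2} from rfl]

/-- With exact SR (`r = ∞`, i.e. `β ≡ 0`, `u_{p+r}`-terms vanish) the model is CHM21's:
`LimitedSRErrorModel μ u_p 0 α 0 ↔ SRErrorModel μ u_p α` ("`SR_{p,r}` uses `r` random bits,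
whereas `SR_p` essentially assumes an infinite value for `r`", §2, p. 4).
[cite: ArarEtAl2026, §2 (p. 4)] -/
theorem limitedSRErrorModel_zero_iff {Ω : Type*} [MeasurableSpace Ω] (μ : Measure Ω) (up : ℝ)
    (α : ℕ → Ω → ℝ) : LimitedSRErrorModel μ up 0 α (fun _ _ => 0) ↔ SRErrorModel μ up α :=
  ⟨fun h => h.meanIndep, fun h => ⟨h, fun _ => measurable_const, fun _ _ => by simp⟩⟩

end Literature.ComputerArithmetic.ElararEtAl2026
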